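import Summits.ValiantsHypothesis.ValiantsHypothesis.Theorems.LacunarySymmetroidMatrixDescartesCensusDefiniteMiddleK3Walk
import Summits.ValiantsHypothesis.ValiantsHypothesis.Theorems.LacunarySymmetroidMatrixDescartesCensusEnvelopeSetup
import Literature.Topology.PlanarFoliations.Monotone

/-!
# `MatrixDescartes` census — DOOR A, interior-definite-letter programme at `(2,3)`: WALK TOOLKIT, part 2
# (sign bookkeeping, simple roots flip the sign, the explicit determinant, end behaviour, caps of constant type)

HONEST FRAMING.  Object-search cell `pub-symmetroid`, door-A seat `val-sym-door-p4` (gen 15); items stmt-ValiantsHypothesis-19979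
`DoorA26` / 19980 `DoorA34` (OPEN, typed, never asserted); helper `--supports 19979`, NO closure claim.  Elementary tools for the
assembly of IDL(3) (`…CensusDefiniteMiddleK3Law`); nothing here bounds a root count of interest by itself, decides
`DoorA26`/`DoorA34`, or bears on `MatrixDescartes` (stmt-ValiantsHypothesis-18050) / `VP ≠ VNP`.

* `same_sign_of_no_zero`, `sgn_chain_neg`, `eq_neg_of_ne_sign`, `pos_of_mul_neg_of_neg` (sign transfer itself is cited:
  `Literature.Topology.PlanarFoliations.mul_pos_of_mul_pos_of_mul_pos`, `Census.sgn_neg_of_mul_neg_of_pos`);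
* `sign_flip_of_simple_root` — a root of multiplicity one is a sign change (`P = (X − ρ)·Q`, `Q(ρ) ≠ 0`, continuity);
* `card_support_six_le`, `det_pencil_eq` (the determinant of `S₀ + x^d·1 + x^e·S₂` expanded: six monomials),
  `eval_det_pencilPoly` (evaluation of the polynomial-matrix determinant);
* `lower_terms_bound`, `top_coeff_sign`, `diag_coeff_sign` — the sign at `+∞` of the explicit determinant / of a diagonal entry
  is the sign of its top coefficient; `no_rise_of_decreasing_ratio`;
* `cap_definite`, `trace_at_right_end`, `trace_at_left_end` — on an interval where `det > 0` the pencil value is definite of ONE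
  type `T = ±1`, and `T·tr ≥ 0` at the endpoints.

[folklore] Elementary real analysis and `2 × 2` algebra.  Axioms standard; no definitions.
-/

-- the D-0017 layout repeats a namespace component (single-conjunct summit); the `dupNamespace` linter flags it; name mandated.
set_option linter.dupNamespace false

namespace Summit.ValiantsHypothesis.ValiantsHypothesis.Theorems.LacunarySymmetroidMatrixDescartes.Census.DefiniteMiddle

open Real Matrix Finset Polynomial
open scoped BigOperators
open Literature.Topology.PlanarFoliations (mul_pos_of_mul_pos_of_mul_pos)

/-! ## §4 Sign bookkeeping, simple roots, the explicit determinant -/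

/-- A continuous function without zeros on `[x, y]` has the same sign at `x` and `y`. [folklore] -/
theorem same_sign_of_no_zero {f : ℝ → ℝ} (hf : Continuous f) {x y : ℝ} (hxy : x ≤ y)
    (hne : ∀ z, x ≤ z → z ≤ y → f z ≠ 0) : 0 < f x * f y := by
  have hx := hne x le_rfl hxy
  have hy := hne y hxy le_rfl
  rcases lt_or_gt_of_ne hx with hx' | hx' <;> rcases lt_or_gt_of_ne hy with hy' | hy'
  · exact mul_pos_of_neg_of_neg hx' hy'
  · obtain ⟨c, hc, hc0⟩ := intermediate_value_Ioo hxy hf.continuousOn ⟨hx', hy'⟩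
    exact absurd hc0 (hne c hc.1.le hc.2.le)
  · obtain ⟨c, hc, hc0⟩ := intermediate_value_Ioo' hxy hf.continuousOn ⟨hy', hx'⟩
    exact absurd hc0 (hne c hc.1.le hc.2.le)
  · exact mul_pos hx' hy'

/-- Sign chain: `ab > 0`, `bc < 0`, `cd > 0` ⇒ `ad < 0`. [folklore] -/
theorem sgn_chain_neg {a b c d : ℝ} (h1 : 0 < a * b) (h2 : b * c < 0) (h3 : 0 < c * d) : a * d < 0 := by
  have h4 : a * c < 0 := by
    rcases mul_pos_iff.mp h1 with ⟨ha, hb⟩ | ⟨ha, hb⟩ <;> rcases mul_neg_iff.mp h2 with ⟨hb', hc⟩ | ⟨hb', hc⟩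
    · exact mul_neg_of_pos_of_neg ha hc
    · exact absurd hb (not_lt.mpr hb'.le)
    · exact absurd hb' (not_lt.mpr hb.le)
    · exact mul_neg_of_neg_of_pos ha hc
  rcases mul_neg_iff.mp h4 with ⟨ha, hc⟩ | ⟨ha, hc⟩ <;> rcases mul_pos_iff.mp h3 with ⟨hc', hd⟩ | ⟨hc', hd⟩
  · exact absurd hc (not_lt.mpr hc'.le)
  · exact mul_neg_of_pos_of_neg ha hd
  · exact mul_neg_of_neg_of_pos ha hd
  · exact absurd hc' (not_lt.mpr hc.le)

/-- Two signs that differ are opposite. [folklore] -/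
theorem eq_neg_of_ne_sign {a b : ℝ} (ha : a = 1 ∨ a = -1) (hb : b = 1 ∨ b = -1) (h : b ≠ a) : b = -a := by
  rcases ha with rfl | rfl <;> rcases hb with rfl | rfl <;> first | exact absurd rfl h | norm_num

/-- `ab < 0`, `a < 0` ⇒ `b > 0`. [folklore] -/
theorem pos_of_mul_neg_of_neg {a b : ℝ} (h : a * b < 0) (ha : a < 0) : 0 < b := by
  rcases mul_neg_iff.mp h with ⟨ha', _⟩ | ⟨_, hb⟩
  · exact absurd ha (not_lt.mpr ha'.le)
  · exact hb

/-- **A simple root is a sign change**: if `P(ρ) = 0` with multiplicity one then `P(ρ − t)·P(ρ + t) < 0` for all small `t > 0`.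
[folklore] -/
theorem sign_flip_of_simple_root (P : ℝ[X]) (hP : P ≠ 0) {ρ : ℝ} (hroot : P.IsRoot ρ) (hmult : P.rootMultiplicity ρ = 1) :
    ∃ η : ℝ, 0 < η ∧ ∀ t : ℝ, 0 < t → t < η → P.eval (ρ - t) * P.eval (ρ + t) < 0 := by
  have hfac : (X - C ρ) * (P /ₘ (X - C ρ)) = P := mul_divByMonic_eq_iff_isRoot.mpr hroot
  set Q := P /ₘ (X - C ρ) with hQ
  have hQρ : Q.eval ρ ≠ 0 := by
    intro h0
    have hdvd : (X - C ρ) ^ 2 ∣ P := by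
      obtain ⟨R, hR⟩ := dvd_iff_isRoot.mpr h0
      refine ⟨R, ?_⟩
      rw [← hfac, hR]; ring
    have := (le_rootMultiplicity_iff hP).mpr hdvd
    omega
  have hev : ∀ᶠ x in nhds ρ, 0 < Q.eval ρ * Q.eval x := by
    have hc : ContinuousAt (fun x => Q.eval ρ * Q.eval x) ρ := (continuous_const.mul Q.continuous).continuousAt
    exact hc.eventually (Ioi_mem_nhds (mul_self_pos.mpr hQρ))
  obtain ⟨η, hη, hball⟩ := Metric.eventually_nhds_iff.mp hev
  refine ⟨η, hη, fun t ht htη => ?_⟩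
  have h1 : 0 < Q.eval ρ * Q.eval (ρ - t) := hball (by rw [Real.dist_eq]; simp [abs_of_pos ht]; exact htη)
  have h2 : 0 < Q.eval ρ * Q.eval (ρ + t) := hball (by rw [Real.dist_eq]; simp [abs_of_pos ht]; exact htη)
  have hev' : ∀ x, P.eval x = (x - ρ) * Q.eval x := fun x => by
    rw [← hfac, eval_mul, eval_sub, eval_X, eval_C]
  rw [hev', hev']
  have hQQ : 0 < Q.eval (ρ - t) * Q.eval (ρ + t) := by
    have := mul_pos h1 h2
    have e : Q.eval ρ * Q.eval (ρ - t) * (Q.eval ρ * Q.eval (ρ + t))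
        = Q.eval ρ ^ 2 * (Q.eval (ρ - t) * Q.eval (ρ + t)) := by ring
    rw [e] at this
    exact pos_of_mul_pos_right this (sq_nonneg _)
  have e2 : (ρ - t - ρ) * Q.eval (ρ - t) * ((ρ + t - ρ) * Q.eval (ρ + t))
      = -(t ^ 2 * (Q.eval (ρ - t) * Q.eval (ρ + t))) := by ring
  rw [e2]
  have : 0 < t ^ 2 * (Q.eval (ρ - t) * Q.eval (ρ + t)) := mul_pos (pow_pos ht 2) hQQ
  linarith

/-- A six-term sum `∑ C cᵢ·X^{nᵢ}` has at most six monomials. [folklore] -/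
theorem card_support_six_le (c₀ c₁ c₂ c₃ c₄ c₅ : ℝ) (n₀ n₁ n₂ n₃ n₄ n₅ : ℕ) :
    (C c₀ * X ^ n₀ + C c₁ * X ^ n₁ + C c₂ * X ^ n₂ + C c₃ * X ^ n₃ + C c₄ * X ^ n₄ + C c₅ * X ^ n₅ : ℝ[X]).support.card
      ≤ 6 := by
  have hsub : (C c₀ * X ^ n₀ + C c₁ * X ^ n₁ + C c₂ * X ^ n₂ + C c₃ * X ^ n₃ + C c₄ * X ^ n₄ + C c₅ * X ^ n₅ :
      ℝ[X]).support ⊆ {n₀, n₁, n₂, n₃, n₄, n₅} := by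
    intro k hk
    rw [mem_support_iff] at hk
    by_contra hk'
    simp only [Finset.mem_insert, Finset.mem_singleton, not_or] at hk'
    apply hk
    simp only [coeff_add, coeff_C_mul_X_pow, hk'.1, hk'.2.1, hk'.2.2.1, hk'.2.2.2.1, hk'.2.2.2.2.1, hk'.2.2.2.2.2,
      if_false, add_zero]
  exact (Finset.card_le_card hsub).trans Finset.card_le_six

/-- The determinant of the pencil value, expanded (six monomials). [folklore] -/
theorem det_pencil_eq (S₀ S₂ : Matrix (Fin 2) (Fin 2) ℝ) (hS₀ : S₀.IsSymm) (hS₂ : S₂.IsSymm) (d e : ℕ) (x : ℝ) :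
    (S₀ + x ^ d • (1 : Matrix (Fin 2) (Fin 2) ℝ) + x ^ e • S₂).det
      = (S₀ 0 0 * S₀ 1 1 - S₀ 0 1 ^ 2) * x ^ 0 + (S₀ 0 0 + S₀ 1 1) * x ^ d + 1 * x ^ (2 * d)
        + (S₀ 0 0 * S₂ 1 1 + S₀ 1 1 * S₂ 0 0 - 2 * (S₀ 0 1 * S₂ 0 1)) * x ^ e + (S₂ 0 0 + S₂ 1 1) * x ^ (d + e)
        + (S₂ 0 0 * S₂ 1 1 - S₂ 0 1 ^ 2) * x ^ (2 * e) := by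
  have h10 : S₀ 1 0 = S₀ 0 1 := hS₀.apply 0 1
  have h10' : S₂ 1 0 = S₂ 0 1 := hS₂.apply 0 1
  rw [Matrix.det_fin_two]
  simp only [pencil_apply, Fin.isValue, ↓reduceIte, one_ne_zero, zero_ne_one, add_zero, h10, h10']
  ring

/-- Evaluation of the polynomial-matrix determinant is the determinant of the pencil value. [folklore] -/
theorem eval_det_pencilPoly (S₀ S₂ : Matrix (Fin 2) (Fin 2) ℝ) (d e : ℕ) (x : ℝ) :
    (Matrix.det (S₀.map C + (X : ℝ[X]) ^ d • (1 : Matrix (Fin 2) (Fin 2) ℝ[X]) + (X : ℝ[X]) ^ e • S₂.map C)).eval x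
      = (S₀ + x ^ d • (1 : Matrix (Fin 2) (Fin 2) ℝ) + x ^ e • S₂).det := by
  rw [← Polynomial.coe_evalRingHom, RingHom.map_det, RingHom.mapMatrix_apply]
  congr 1
  ext i j
  fin_cases i <;> fin_cases j <;> simp <;> ring


/-! ## §5 End behaviour of the explicit determinant and of a diagonal entry -/

/-- Tail bound: for `x ≥ 1` the five lower monomials of the explicit determinant are `≤ K·x^{2e−1}` in absolute value
(`0 < d < e`). [folklore] -/
theorem lower_terms_bound (δ₀ τ₀ β τ₂ : ℝ) {d e : ℕ} (hde : d < e) (x : ℝ) (hx : 1 ≤ x) :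
    |δ₀ * x ^ 0 + τ₀ * x ^ d + 1 * x ^ (2 * d) + β * x ^ e + τ₂ * x ^ (d + e)|
      ≤ (|δ₀| + |τ₀| + |(1:ℝ)| + |β| + |τ₂|) * x ^ (2 * e - 1) := by
  refine (abs_add_le _ _).trans ((add_le_add (abs_add_le _ _) le_rfl).trans ?_)
  refine (add_le_add (add_le_add (abs_add_le _ _) le_rfl) le_rfl).trans ?_
  refine (add_le_add (add_le_add (add_le_add (abs_add_le _ _) le_rfl) le_rfl) le_rfl).trans ?_
  have e1 := abs_mul_pow_le (a := δ₀) hx (show 0 ≤ 2 * e - 1 by omega)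
  have e2 := abs_mul_pow_le (a := τ₀) hx (show d ≤ 2 * e - 1 by omega)
  have e3 := abs_mul_pow_le (a := (1:ℝ)) hx (show 2 * d ≤ 2 * e - 1 by omega)
  have e4 := abs_mul_pow_le (a := β) hx (show e ≤ 2 * e - 1 by omega)
  have e5 := abs_mul_pow_le (a := τ₂) hx (show d + e ≤ 2 * e - 1 by omega)
  linarith [e1, e2, e3, e4, e5]

/-- **Sign of the top coefficient from the sign at `+∞`.**  If the explicit six-term determinant has sign `s` (`= ±1`)
at every `x > R` and its top coefficient `δ₂` is nonzero, then `s·δ₂ > 0`. [folklore] -/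
theorem top_coeff_sign (δ₀ τ₀ β τ₂ δ₂ : ℝ) {d e : ℕ} (hde : d < e) (s R : ℝ) (hs : s = 1 ∨ s = -1)
    (hδ₂ : δ₂ ≠ 0)
    (hR : ∀ x : ℝ, R < x → 0 < s * (δ₀ * x ^ 0 + τ₀ * x ^ d + 1 * x ^ (2 * d) + β * x ^ e + τ₂ * x ^ (d + e)
      + δ₂ * x ^ (2 * e))) : 0 < s * δ₂ := by
  by_contra hle
  rw [not_lt] at hle
  have hs2 : s * s = 1 := by rcases hs with rfl | rfl <;> norm_num
  have hneg : s * δ₂ < 0 := lt_of_le_of_ne hle (by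
    intro h0; rcases hs with rfl | rfl
    · exact hδ₂ (by linarith)
    · exact hδ₂ (by linarith))
  set K : ℝ := |δ₀| + |τ₀| + |(1:ℝ)| + |β| + |τ₂| with hK
  have hbig := eventually_pos_of_dominant
    (L := fun x => -s * (δ₀ * x ^ 0 + τ₀ * x ^ d + 1 * x ^ (2 * d) + β * x ^ e + τ₂ * x ^ (d + e)))
    (K := K) (c := -(s * δ₂)) (n := 2 * e - 1) (by linarith) (fun x hx => by
      rw [abs_mul, abs_neg, show |s| = 1 by rcases hs with rfl | rfl <;> norm_num, one_mul]
      exact lower_terms_bound δ₀ τ₀ β τ₂ hde x hx)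
  set x := max (R + 1) (max 1 (K / (-(s * δ₂)) + 1)) with hxdef
  have h1 := hbig x (le_max_right _ _)
  have h2e : 2 * e - 1 + 1 = 2 * e := by omega
  rw [h2e] at h1
  have h2 := hR x (lt_of_lt_of_le (by linarith) (le_max_left _ _))
  linarith

/-- **Sign of a diagonal letter entry from the sign at `+∞`.**  If `T·(a + x^d + c·x^e) > 0` for every `x > R`
(`T = ±1`, `0 < d < e`, `c ≠ 0`) then `T·c > 0`. [folklore] -/
theorem diag_coeff_sign (a c : ℝ) {d e : ℕ} (hde : d < e) (T R : ℝ) (hT : T = 1 ∨ T = -1) (hc : c ≠ 0)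
    (hR : ∀ x : ℝ, R < x → 0 < T * (a + x ^ d + x ^ e * c)) : 0 < T * c := by
  by_contra hle
  rw [not_lt] at hle
  have hneg : T * c < 0 := lt_of_le_of_ne hle (by
    intro h0; rcases hT with rfl | rfl
    · exact hc (by linarith)
    · exact hc (by linarith))
  have hbig := eventually_pos_of_dominant (L := fun x => -T * (a + x ^ d)) (K := |a| + 1) (c := -(T * c))
    (n := e - 1) (by linarith) (fun x hx => by
      rw [abs_mul, abs_neg, show |T| = 1 by rcases hT with rfl | rfl <;> norm_num, one_mul]
      have hxpow : (1:ℝ) ≤ x ^ (e - 1) := one_le_pow₀ hx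
      have hxd : x ^ d ≤ x ^ (e - 1) := pow_le_pow_right₀ hx (by omega)
      have hxd0 : 0 ≤ x ^ d := by positivity
      have ha := mul_le_mul_of_nonneg_left hxpow (abs_nonneg a)
      calc |a + x ^ d| ≤ |a| + |x ^ d| := abs_add_le _ _
        _ = |a| + x ^ d := by rw [abs_of_nonneg hxd0]
        _ ≤ |a| * x ^ (e - 1) + x ^ (e - 1) := by linarith
        _ = (|a| + 1) * x ^ (e - 1) := by ring)
  set x := max (R + 1) (max 1 ((|a| + 1) / (-(T * c)) + 1)) with hxdef
  have h1 := hbig x (le_max_right _ _)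
  have he1 : e - 1 + 1 = e := by omega
  rw [he1] at h1
  have h2 := hR x (lt_of_lt_of_le (by linarith) (le_max_left _ _))
  nlinarith [h1, h2]

/-- **Decreasing ratio.**  For `α ≥ 0`, `β > 0` and `d < e` the trinomial `α + βx^d + γx^e` cannot be negative at `m₁` and
positive at `m₃ ≥ m₁ > 0` (`(α + βx^d)/x^e` decreases; the signs force `γ < 0`). [folklore] -/
theorem no_rise_of_decreasing_ratio {α β γ m₁ m₃ : ℝ} {d e : ℕ} (hde : d < e) (hα : 0 ≤ α) (hβ : 0 < β)
    (h1 : 0 < m₁) (h13 : m₁ ≤ m₃) (hneg : α + β * m₁ ^ d + γ * m₁ ^ e < 0) (hpos : 0 < α + β * m₃ ^ d + γ * m₃ ^ e) :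
    False := by
  have h3 : 0 < m₃ := lt_of_lt_of_le h1 h13
  have hm1d : 0 < m₁ ^ d := pow_pos h1 d
  have hm1e : 0 < m₁ ^ e := pow_pos h1 e
  have hm3d : 0 < m₃ ^ d := pow_pos h3 d
  have hm3e : 0 < m₃ ^ e := pow_pos h3 e
  have i1 : α + β * m₁ ^ d < -γ * m₁ ^ e := by linarith
  have i3 : -γ * m₃ ^ e < α + β * m₃ ^ d := by linarith
  have hsplit1 : m₁ ^ e = m₁ ^ d * m₁ ^ (e - d) := by rw [← pow_add]; congr 1; omega
  have hsplit3 : m₃ ^ e = m₃ ^ d * m₃ ^ (e - d) := by rw [← pow_add]; congr 1; omega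
  have hed : m₁ ^ (e - d) ≤ m₃ ^ (e - d) := pow_le_pow_left₀ h1.le h13 _
  have hee : m₁ ^ e ≤ m₃ ^ e := pow_le_pow_left₀ h1.le h13 _
  have key : (α + β * m₃ ^ d) * m₁ ^ e ≤ (α + β * m₁ ^ d) * m₃ ^ e := by
    have a1 : α * m₁ ^ e ≤ α * m₃ ^ e := mul_le_mul_of_nonneg_left hee hα
    have a2 : m₃ ^ d * m₁ ^ e ≤ m₁ ^ d * m₃ ^ e := by
      rw [hsplit1, hsplit3]
      have := mul_le_mul_of_nonneg_left hed (mul_nonneg hm1d.le hm3d.le)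
      nlinarith
    nlinarith [mul_le_mul_of_nonneg_left a2 hβ.le]
  nlinarith [mul_lt_mul_of_pos_right i1 hm3e, mul_lt_mul_of_pos_right i3 hm1e]

/-! ## §6 Caps: definiteness of a constant type on an interval where `det > 0`, and the trace at its endpoints -/

/-- **A cap has a constant type.**  If `det(S₀ + x^d·1 + x^e·S₂) > 0` for all `x ∈ (lo, hi)` (`S₀, S₂` symmetric) then for
one sign `T = ±1` the pencil value is `T`-definite on the whole interval (`T` = the sign of the `(0,0)` entry, which cannot
vanish and is continuous). [folklore] -/
theorem cap_definite (S₀ S₂ : Matrix (Fin 2) (Fin 2) ℝ) (hS₀ : S₀.IsSymm) (hS₂ : S₂.IsSymm) (d e : ℕ) {lo hi mm : ℝ}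
    (hmm : lo < mm) (hmm' : mm < hi)
    (hdet : ∀ x, lo < x → x < hi → 0 < (S₀ + x ^ d • (1 : Matrix (Fin 2) (Fin 2) ℝ) + x ^ e • S₂).det) :
    ∃ T : ℝ, (T = 1 ∨ T = -1) ∧ ∀ x, lo < x → x < hi → ∀ v : Fin 2 → ℝ, v ≠ 0 →
      0 < T * (v ⬝ᵥ ((S₀ + x ^ d • (1 : Matrix (Fin 2) (Fin 2) ℝ) + x ^ e • S₂) *ᵥ v)) := by
  have h10 : S₀ 1 0 = S₀ 0 1 := hS₀.apply 0 1
  have h10' : S₂ 1 0 = S₂ 0 1 := hS₂.apply 0 1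
  have hFs : ∀ x : ℝ, (S₀ + x ^ d • (1 : Matrix (Fin 2) (Fin 2) ℝ) + x ^ e • S₂) 1 0
      = (S₀ + x ^ d • (1 : Matrix (Fin 2) (Fin 2) ℝ) + x ^ e • S₂) 0 1 := by
    intro x; rw [pencil_apply, pencil_apply, h10]; simp [h10']
  have hF00 : ∀ x : ℝ, (S₀ + x ^ d • (1 : Matrix (Fin 2) (Fin 2) ℝ) + x ^ e • S₂) 0 0
      = S₀ 0 0 + x ^ d + x ^ e * S₂ 0 0 := fun x => by rw [pencil_apply]; simp
  have hcont00 : Continuous fun x : ℝ => (S₀ + x ^ d • (1 : Matrix (Fin 2) (Fin 2) ℝ) + x ^ e • S₂) 0 0 := by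
    simp only [hF00]; fun_prop
  have hdpos : ∀ x, lo < x → x < hi →
      0 < (S₀ + x ^ d • (1 : Matrix (Fin 2) (Fin 2) ℝ) + x ^ e • S₂) 0 0
          * (S₀ + x ^ d • (1 : Matrix (Fin 2) (Fin 2) ℝ) + x ^ e • S₂) 1 1
        - (S₀ + x ^ d • (1 : Matrix (Fin 2) (Fin 2) ℝ) + x ^ e • S₂) 0 1 ^ 2 := by
    intro x hx hx'
    have := hdet x hx hx'
    rwa [Matrix.det_fin_two, hFs, ← sq] at this
  have h00ne : ∀ x, lo < x → x < hi → (S₀ + x ^ d • (1 : Matrix (Fin 2) (Fin 2) ℝ) + x ^ e • S₂) 0 0 ≠ 0 := by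
    intro x hx hx' h0
    have := hdpos x hx hx'
    rw [h0, zero_mul] at this
    nlinarith [sq_nonneg ((S₀ + x ^ d • (1 : Matrix (Fin 2) (Fin 2) ℝ) + x ^ e • S₂) 0 1)]
  set a := (S₀ + mm ^ d • (1 : Matrix (Fin 2) (Fin 2) ℝ) + mm ^ e • S₂) 0 0 with ha
  refine ⟨if 0 < a then 1 else -1, by by_cases h : 0 < a <;> simp [h], ?_⟩
  intro x hx hx' v hv
  have h1 := mul_quadform_pos_of_det_pos _ (hFs x) (hdpos x hx hx') v hv
  have h2 : 0 < a * (S₀ + x ^ d • (1 : Matrix (Fin 2) (Fin 2) ℝ) + x ^ e • S₂) 0 0 := by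
    rw [ha]
    rcases le_total mm x with h | h
    · exact same_sign_of_no_zero hcont00 h (fun z hz1 hz2 => h00ne z (by linarith) (by linarith))
    · rw [mul_comm]; exact same_sign_of_no_zero hcont00 h (fun z hz1 hz2 => h00ne z (by linarith) (by linarith))
  have h3 : 0 < (if 0 < a then (1:ℝ) else -1) * a := by
    by_cases h : 0 < a
    · simp [h]
    · simp [h]
      exact lt_of_le_of_ne (not_lt.mp h) (by rw [ha]; exact h00ne mm hmm hmm')
  exact mul_pos_of_mul_pos_of_mul_pos (mul_pos_of_mul_pos_of_mul_pos h3 h2) h1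

/-- **Trace sign at the right endpoint of a cap** of type `T`: `T·tr F(ρ) ≥ 0`. [folklore] -/
theorem trace_at_right_end (S₀ S₂ : Matrix (Fin 2) (Fin 2) ℝ) (hS₀ : S₀.IsSymm) (hS₂ : S₂.IsSymm) (d e : ℕ)
    (T : ℝ) {lo ρ : ℝ} (hlo : lo < ρ)
    (hdef : ∀ x, lo < x → x < ρ → ∀ v : Fin 2 → ℝ, v ≠ 0 →
      0 < T * (v ⬝ᵥ ((S₀ + x ^ d • (1 : Matrix (Fin 2) (Fin 2) ℝ) + x ^ e • S₂) *ᵥ v))) :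
    0 ≤ T * ((S₀ + ρ ^ d • (1 : Matrix (Fin 2) (Fin 2) ℝ) + ρ ^ e • S₂) 0 0
      + (S₀ + ρ ^ d • (1 : Matrix (Fin 2) (Fin 2) ℝ) + ρ ^ e • S₂) 1 1) := by
  have h10 : S₀ 1 0 = S₀ 0 1 := hS₀.apply 0 1
  have h10' : S₂ 1 0 = S₂ 0 1 := hS₂.apply 0 1
  have hF00 : ∀ x : ℝ, (S₀ + x ^ d • (1 : Matrix (Fin 2) (Fin 2) ℝ) + x ^ e • S₂) 0 0
      = S₀ 0 0 + x ^ d + x ^ e * S₂ 0 0 := fun x => by rw [pencil_apply]; simp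
  have hF11 : ∀ x : ℝ, (S₀ + x ^ d • (1 : Matrix (Fin 2) (Fin 2) ℝ) + x ^ e • S₂) 1 1
      = S₀ 1 1 + x ^ d + x ^ e * S₂ 1 1 := fun x => by rw [pencil_apply]; simp
  have hcont : Continuous fun x : ℝ => T * ((S₀ + x ^ d • (1 : Matrix (Fin 2) (Fin 2) ℝ) + x ^ e • S₂) 0 0
      + (S₀ + x ^ d • (1 : Matrix (Fin 2) (Fin 2) ℝ) + x ^ e • S₂) 1 1) := by
    simp only [hF00, hF11]; fun_prop
  refine nonneg_of_pos_on_left (f := fun x => T * ((S₀ + x ^ d • (1 : Matrix (Fin 2) (Fin 2) ℝ) + x ^ e • S₂) 0 0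
      + (S₀ + x ^ d • (1 : Matrix (Fin 2) (Fin 2) ℝ) + x ^ e • S₂) 1 1)) hlo hcont.continuousAt (fun x hx hx' => ?_)
  have hFs : (S₀ + x ^ d • (1 : Matrix (Fin 2) (Fin 2) ℝ) + x ^ e • S₂) 1 0
      = (S₀ + x ^ d • (1 : Matrix (Fin 2) (Fin 2) ℝ) + x ^ e • S₂) 0 1 := by
    rw [pencil_apply, pencil_apply, h10]; simp [h10']
  have h1 := hdef x hx hx' ![1, 0] (by intro h; have := congrFun h 0; simp at this)
  have h2 := hdef x hx hx' ![0, 1] (by intro h; have := congrFun h 1; simp at this)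
  rw [quadform_eq _ hFs] at h1 h2
  simp at h1 h2
  simp only [hF00, hF11]
  linarith

/-- **Trace sign at the left endpoint of a cap** of type `T`: `T·tr F(ρ) ≥ 0`. [folklore] -/
theorem trace_at_left_end (S₀ S₂ : Matrix (Fin 2) (Fin 2) ℝ) (hS₀ : S₀.IsSymm) (hS₂ : S₂.IsSymm) (d e : ℕ)
    (T : ℝ) {ρ hi : ℝ} (hhi : ρ < hi)
    (hdef : ∀ x, ρ < x → x < hi → ∀ v : Fin 2 → ℝ, v ≠ 0 →
      0 < T * (v ⬝ᵥ ((S₀ + x ^ d • (1 : Matrix (Fin 2) (Fin 2) ℝ) + x ^ e • S₂) *ᵥ v))) :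
    0 ≤ T * ((S₀ + ρ ^ d • (1 : Matrix (Fin 2) (Fin 2) ℝ) + ρ ^ e • S₂) 0 0
      + (S₀ + ρ ^ d • (1 : Matrix (Fin 2) (Fin 2) ℝ) + ρ ^ e • S₂) 1 1) := by
  have h10 : S₀ 1 0 = S₀ 0 1 := hS₀.apply 0 1
  have h10' : S₂ 1 0 = S₂ 0 1 := hS₂.apply 0 1
  have hF00 : ∀ x : ℝ, (S₀ + x ^ d • (1 : Matrix (Fin 2) (Fin 2) ℝ) + x ^ e • S₂) 0 0
      = S₀ 0 0 + x ^ d + x ^ e * S₂ 0 0 := fun x => by rw [pencil_apply]; simp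
  have hF11 : ∀ x : ℝ, (S₀ + x ^ d • (1 : Matrix (Fin 2) (Fin 2) ℝ) + x ^ e • S₂) 1 1
      = S₀ 1 1 + x ^ d + x ^ e * S₂ 1 1 := fun x => by rw [pencil_apply]; simp
  have hcont : Continuous fun x : ℝ => T * ((S₀ + x ^ d • (1 : Matrix (Fin 2) (Fin 2) ℝ) + x ^ e • S₂) 0 0
      + (S₀ + x ^ d • (1 : Matrix (Fin 2) (Fin 2) ℝ) + x ^ e • S₂) 1 1) := by
    simp only [hF00, hF11]; fun_prop
  refine nonneg_of_pos_on_right (f := fun x => T * ((S₀ + x ^ d • (1 : Matrix (Fin 2) (Fin 2) ℝ) + x ^ e • S₂) 0 0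
      + (S₀ + x ^ d • (1 : Matrix (Fin 2) (Fin 2) ℝ) + x ^ e • S₂) 1 1)) hhi hcont.continuousAt (fun x hx hx' => ?_)
  have hFs : (S₀ + x ^ d • (1 : Matrix (Fin 2) (Fin 2) ℝ) + x ^ e • S₂) 1 0
      = (S₀ + x ^ d • (1 : Matrix (Fin 2) (Fin 2) ℝ) + x ^ e • S₂) 0 1 := by
    rw [pencil_apply, pencil_apply, h10]; simp [h10']
  have h1 := hdef x hx hx' ![1, 0] (by intro h; have := congrFun h 0; simp at this)
  have h2 := hdef x hx hx' ![0, 1] (by intro h; have := congrFun h 1; simp at this)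
  rw [quadform_eq _ hFs] at h1 h2
  simp at h1 h2
  simp only [hF00, hF11]
  linarith

end Summit.ValiantsHypothesis.ValiantsHypothesis.Theorems.LacunarySymmetroidMatrixDescartes.Census.DefiniteMiddle
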